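import Summits.ABC.StewartYu.PadicG3Schedule
import Summits.ABC.StewartYu.PadicG3TwoFeldmanBasis
import Summits.ABC.StewartYu.FeldmanZeroDirectionWeights
import HarnessLib

/-!
# Cell abc-stewartyu, crux `Y07Odd` (stmt-ABC-19658), line `gen3-slab-odd`: FRAME-SIDE SUPPLY for the record packages — the structural
# (non-numeric) data of `KStepHypU` / `KStepOddHypU` / `HalfStepHypU` / START in closed form: coefficient sizes of the level polynomials,
# integrality and size of their Hasse values, the half-point relation, the directional bound

`Summits/ABC/StewartYu/PadicG3Supply.lean` — cell `abc-stewartyu` (seat p2-g4, F-odd lead; for the record owners p1/lp-1, plan g8 ruling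
2026-08-27T02:41Z).  Theorems on `G3Setup`; no named fact.  For the level polynomials `Rl H Ŝ lev i = feldR ℓ₀ H ∘ (2^{Ŝ−lev} Y₀)`:

* `coeff_hw_Rl` / `norm_coeff_hw_Rl_le` / `norm_coeff_hw_Rl_mul_pow_le` — `‖coeff_k(hw (Rl lev) i t₀)‖_p ≤ ‖den(ℓ₀,H)⁻¹‖_p` and
  `‖coeff_k‖·ρᵏ ≤ ‖den⁻¹‖·ρ^{ℓ₀}` (`ρ ≥ 1`): the `Bw` of the packages is `max_{ℓ₀ ≤ L₀} ‖den⁻¹‖·ρ^{L₀}`;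
* `hasse_Rl_eval_intCast`, `exists_int_lcm_pow_mul_hasse_Rl` — `(Hasse_t Rl lev i)(x) = 2^{(Ŝ−lev)t}·(Hasse_t feldR)(2^{Ŝ−lev}x)`, so
  `den₀ := ν(H)^t` clears it with size `≤ 2^{(Ŝ−lev)t} ν(H)^t e^{H/e} (e(1 + 2^{Ŝ−lev}|x|/H))^{ℓ₀}`;
* `hasse_Rl_half` — `(Hasse_t Rl lev i)(s₁/2) = 2^t · (Hasse_t Rl (lev+1) i)(s₁)` for `lev < Ŝ` (the `hRR′` of `HalfStepHypU`, `c t = 2^t`);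
* `abs_𝔛_le_of_box` — `|𝔛 w k| ≤ |b_{j₀}| L_k + |b_k| L_{j₀}` on the box.

WHAT THIS IS NOT: no inequality between parameters (the record's budgets); no crux moves.

References: Yu. V. Nesterenko, LNM 1819 (2003) §3.1 Prop 3.1, (4.20); K. Yu, Acta Math. 211 (2013) (5.4).
-/

noncomputable section

open NormedSpace Finset Polynomial
open Literature.NumberTheory.Transcendental
open Literature.NumberTheory.Transcendental (FeldmanDelta.num FeldmanDelta.den)
open Literature.NumberTheory.Transcendental.FeldmanDelta
open Summit.ABC.StewartYu.FeldmanBasis (feldR natDegree_feldR_le)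
open scoped Nat

namespace Summit.ABC.StewartYu

namespace G3Setup

variable {p : ℕ} [Fact p.Prime] (S : G3Setup p)

/-! ### Coefficients of the level polynomials -/

/-- The coefficients of `hw (Rl lev) i t₀`: `choose(k+t₀, t₀) · den⁻¹ · numcoeff_{k+t₀} · (2^{Ŝ−lev})^{k+t₀}`, an integer over `den`. [folklore] -/
theorem norm_coeff_hw_Rl_le (H Sh lev : ℕ) (i : ℕ × (Fin S.n → ℤ)) (t₀ k : ℕ) :
    ‖(hw (p := p) (S.Rl H Sh lev) i t₀).coeff k‖ ≤ ‖((den i.1 H : ℚ_[p]))⁻¹‖ := by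
  unfold hw Rl feldR
  rw [Polynomial.coeff_map, hasseDeriv_coeff, comp_C_mul_X_coeff, coeff_C_mul]
  obtain ⟨z, hz⟩ : ∃ z : ℤ, (num ℚ i.1 H).coeff (k + t₀) = (z : ℚ) :=
    ⟨(num ℤ i.1 H).coeff (k + t₀), FeldmanBasis.coeff_num_rat_eq_intCast _ _ _⟩
  rw [hz]
  simp only [map_mul, map_natCast, map_pow, eq_ratCast]
  push_cast
  have h2 : ‖(2 : ℚ_[p]) ^ (Sh - lev)‖ = 1 := by rw [norm_pow, PadicExp.norm_two_eq_one S.hp3, one_pow]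
  rw [norm_mul, norm_mul, norm_mul, norm_pow, h2, one_pow, mul_one]
  calc ‖(((k + t₀).choose t₀ : ℕ) : ℚ_[p])‖ * (‖((den i.1 H : ℚ_[p]))⁻¹‖ * ‖(z : ℚ_[p])‖)
      ≤ 1 * (‖((den i.1 H : ℚ_[p]))⁻¹‖ * 1) := by
        refine mul_le_mul ?_ (mul_le_mul_of_nonneg_left (Padic.norm_int_le_one z) (norm_nonneg _)) (by positivity) zero_le_one
        exact_mod_cast Padic.norm_int_le_one (p := p) (((k + t₀).choose t₀ : ℕ) : ℤ)
    _ = ‖((den i.1 H : ℚ_[p]))⁻¹‖ := by ring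

/-- **The weighted coefficient bound of the packages**: for `ρ ≥ 1`, `‖coeff_k(hw (Rl lev) i t₀)‖·ρᵏ ≤ ‖den(ℓ₀,H)⁻¹‖·ρ^{ℓ₀}`.
[cite: Nesterenko2003, §3.1; shape only] -/
theorem norm_coeff_hw_Rl_mul_pow_le (H Sh lev : ℕ) (i : ℕ × (Fin S.n → ℤ)) (t₀ k : ℕ) {ρ : ℝ} (hρ1 : 1 ≤ ρ) :
    ‖(hw (p := p) (S.Rl H Sh lev) i t₀).coeff k‖ * ρ ^ k ≤ ‖((den i.1 H : ℚ_[p]))⁻¹‖ * ρ ^ i.1 := by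
  by_cases hk : k ≤ i.1
  · exact mul_le_mul (S.norm_coeff_hw_Rl_le H Sh lev i t₀ k) (pow_le_pow_right₀ hρ1 hk) (by positivity) (norm_nonneg _)
  · have hdeg : (hw (p := p) (S.Rl H Sh lev) i t₀).natDegree < k := by
      unfold hw Rl
      have h1 : (hasseDeriv t₀ ((feldR i.1 H).comp (C ((2 : ℚ) ^ (Sh - lev)) * X))).natDegree ≤ i.1 := by
        refine (natDegree_hasseDeriv_le _ _).trans ((Nat.sub_le _ _).trans ?_)
        rw [natDegree_comp, natDegree_C_mul (pow_ne_zero _ two_ne_zero), natDegree_X, mul_one]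
        exact natDegree_feldR_le _ _
      exact lt_of_le_of_lt ((natDegree_map_le).trans h1) (by omega)
    rw [coeff_eq_zero_of_natDegree_lt hdeg, norm_zero, zero_mul]
    positivity

/-! ### Hasse values of the level polynomials at integers and half-integers -/

/-- `(Hasse_t Rl lev i)(x) = 2^{(Ŝ−lev)t} · (Hasse_t feldR ℓ₀ H)(2^{Ŝ−lev} x)`. [folklore] -/
theorem hasse_Rl_eval (H Sh lev : ℕ) (i : ℕ × (Fin S.n → ℤ)) (t : ℕ) (y : ℚ) :
    (hasseDeriv t (S.Rl H Sh lev i)).eval y = ((2 : ℚ) ^ (Sh - lev)) ^ t * (hasseDeriv t (feldR i.1 H)).eval ((2 : ℚ) ^ (Sh - lev) * y) := by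
  unfold Rl
  exact G3Output.hasseDeriv_comp_C_mul_X_eval _ _ _ _

/-- **Integrality and size of the Hasse values at integer points** (`den₀ = ν(H)^t`): `ν(H)^t · (Hasse_t Rl lev i)(x) ∈ ℤ` with
`|·| ≤ M₀` as soon as `M₀ ≥ 2^{(Ŝ−lev)t} ν(H)^t e^{H/e} (e(1 + 2^{Ŝ−lev}|x|/H))^{ℓ₀}`. [cite: Nesterenko2003, §3.1 Prop 3.1] -/
theorem exists_int_lcm_pow_mul_hasse_Rl {H : ℕ} (hH : 1 ≤ H) (Sh lev : ℕ) (i : ℕ × (Fin S.n → ℤ)) (t : ℕ) (x : ℤ) {M₀ : ℤ}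
    (hM : (2 : ℝ) ^ ((Sh - lev) * t) * ((Nat.lcmUpto H : ℝ) ^ t *
      (Real.exp (H / Real.exp 1) * (Real.exp 1 * (1 + |((2 ^ (Sh - lev) * x : ℤ) : ℝ)| / H)) ^ i.1)) ≤ M₀) :
    ∃ z₀ : ℤ, (((Nat.lcmUpto H) ^ t : ℕ) : ℚ) * (hasseDeriv t (S.Rl H Sh lev i)).eval (x : ℚ) = z₀ ∧ |z₀| ≤ M₀ := by
  -- the integer value at `2^{Ŝ−lev} x` is Fel'dman's `zeroWeight`
  set z₁ : ℤ := DirWeights.zeroWeight i.1 H t (2 ^ (Sh - lev) * x) with hz₁def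
  have hz₁ : (((Nat.lcmUpto H) ^ t : ℕ) : ℚ) * (hasseDeriv t (feldR i.1 H)).eval (((2 ^ (Sh - lev) * x : ℤ)) : ℚ) = (z₁ : ℚ) :=
    FeldmanBasis.lcm_pow_mul_hasse_feldR_eq_zeroWeight i.1 hH t _
  have hz₁le : |(z₁ : ℝ)| ≤ (Nat.lcmUpto H : ℝ) ^ t *
      (Real.exp (H / Real.exp 1) * (Real.exp 1 * (1 + |((2 ^ (Sh - lev) * x : ℤ) : ℝ)| / H)) ^ i.1) :=
    DirWeights.abs_zeroWeight_le i.1 hH t _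
  refine ⟨2 ^ ((Sh - lev) * t) * z₁, ?_, ?_⟩
  · rw [S.hasse_Rl_eval]
    push_cast at hz₁ ⊢
    rw [← pow_mul]
    calc ((Nat.lcmUpto H : ℚ)) ^ t * ((2 : ℚ) ^ ((Sh - lev) * t) * (hasseDeriv t (feldR i.1 H)).eval ((2 : ℚ) ^ (Sh - lev) * (x : ℚ)))
        = (2 : ℚ) ^ ((Sh - lev) * t) * (((Nat.lcmUpto H : ℚ)) ^ t * (hasseDeriv t (feldR i.1 H)).eval ((2 : ℚ) ^ (Sh - lev) * (x : ℚ))) := by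
          ring
      _ = (2 : ℚ) ^ ((Sh - lev) * t) * (z₁ : ℚ) := by rw [hz₁]
  · rw [abs_mul, abs_pow, abs_two]
    have h2 : (0 : ℝ) ≤ (2 : ℝ) ^ ((Sh - lev) * t) := by positivity
    have : ((2 : ℤ) ^ ((Sh - lev) * t) * |z₁| : ℤ) ≤ M₀ := by
      have h3 : (((2 : ℤ) ^ ((Sh - lev) * t) * |z₁| : ℤ) : ℝ) ≤ M₀ := by
        push_cast
        exact le_trans (mul_le_mul_of_nonneg_left hz₁le h2) hM
      exact_mod_cast h3
    exact this

/-- **The half-point relation** (the `hRR′` of `HalfStepHypU` with `c t = 2^t`): for `lev < Ŝ`,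
`(Hasse_t Rl lev i)(s₁/2) = 2^t · (Hasse_t Rl (lev+1) i)(s₁)`. [cite: Nesterenko2003, (4.20); shape only] -/
theorem hasse_Rl_half {H Sh lev : ℕ} (hlev : lev < Sh) (i : ℕ × (Fin S.n → ℤ)) (t : ℕ) (s₁ : ℤ) :
    (hasseDeriv t (S.Rl H Sh lev i)).eval ((s₁ : ℚ) / 2) = (2 : ℚ) ^ t * (hasseDeriv t (S.Rl H Sh (lev + 1) i)).eval (s₁ : ℚ) := by
  rw [S.hasse_Rl_eval, S.hasse_Rl_eval]
  have he : Sh - lev = (Sh - (lev + 1)) + 1 := by omega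
  rw [he, pow_succ]
  have harg : (2 : ℚ) ^ (Sh - (lev + 1)) * 2 * ((s₁ : ℚ) / 2) = (2 : ℚ) ^ (Sh - (lev + 1)) * (s₁ : ℚ) := by ring
  rw [harg, mul_pow]
  ring

/-! ### The directional bound on a box -/

/-- **`|𝔛 w k| ≤ |b_{j₀}|·L_k + |b_k|·L_{j₀}`** when `|w_j| ≤ L_j`. [folklore] -/
theorem abs_𝔛_le_of_box {L : Fin S.n → ℕ} {w : Fin S.n → ℤ} (hw : ∀ j, |w j| ≤ (L j : ℤ)) (k : Fin S.n) :
    |S.𝔛 w k| ≤ |S.b S.j₀| * L k + |S.b k| * L S.j₀ := by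
  unfold 𝔛
  calc |S.b S.j₀ * w k - S.b k * w S.j₀| ≤ |S.b S.j₀ * w k| + |S.b k * w S.j₀| := abs_sub _ _
    _ = |S.b S.j₀| * |w k| + |S.b k| * |w S.j₀| := by rw [abs_mul, abs_mul]
    _ ≤ |S.b S.j₀| * L k + |S.b k| * L S.j₀ :=
        add_le_add (mul_le_mul_of_nonneg_left (hw k) (abs_nonneg _)) (mul_le_mul_of_nonneg_left (hw S.j₀) (abs_nonneg _))

end G3Setup

end Summit.ABC.StewartYu

end
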